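import Mathlib
import Summits.Ventures.PercRepro2.KPrimeReduction
import Summits.Ventures.PercRepro2.KPrimeSure
import Summits.Ventures.PercRepro2.KPrimeInduction
import Summits.Ventures.PercRepro2.KPrimeVEdge
import Summits.Ventures.PercRepro2.KPrimeVBase
import Summits.Ventures.PercRepro2.KPrimeVInduction
import Summits.Ventures.PercRepro2.KPrimeVYDict
import Summits.Ventures.PercRepro2.KPrimeVYEdge
import Summits.Ventures.PercRepro2.KPrimeVBAlgebra
import Summits.Ventures.PercRepro2.KPrimeVBEdge

/-!
# The `v`-exploration of `(K′)`, FREE EDGES ONLY: `(STEP-v-free) ⟹ (K′)` — `KPrime.kprime_of_vstep_free`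
(blind cell PercRepro2, mine-c g35; `conjectures/MINE-C.md` §44.2)

`kprime_of_vstep` (`KPrimeVInduction.lean`, g33) derives `(K′)` for every instance from the
one-edge implication `(STEP-v′)` at every unresolved edge `e = {x, z}` from the weight-`1` root of
`v` to a vertex `z` outside the roots of `v`, `a₁`, `a₂`.  Two of those edge classes are now
theorems: `z = y` (`kprimeHolds_of_update_zero_vy`: `(K′)(p[e ↦ 0]) → (K′)(p)`) and `z = b`
(`kprimeHolds_of_update_zero_vb`: `(K′)(p[e ↦ 0]) → (K′)(p[e ↦ 0]; y := b) → (K′)(p)`).  Running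
the induction over ALL marks `y` at once makes the second hypothesis of the `v`–`b` step available,
and the one-edge implication is then needed only at the edges into a FREE vertex
`z ∉ {b, y} ∪ root(v) ∪ root(a₁) ∪ root(a₂)`:

  `(STEP-v-free)  ∀ y p e, e free v-root edge → (K′)(p[e ↦ 0]) → (K′)(p[e ↦ 1]) → (K′)(p)`,

**Theorem** (`kprime_of_vstep_free`): `(STEP-v-free)` implies `(K′)` for every instance and every
mark `y`.  `(STEP-v-free)` is NOT proved here (`MINE-C.md` §43.11–43.13: its brace form is false
by a hair, its implication form is the open piece of the lane).
-/

namespace Summit.Ventures.PercRepro2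

namespace KPrime

variable {V : Type*} {E : Type*} [Fintype E] [DecidableEq E] [Fintype V] [DecidableEq V]
  {R : Type*} [Field R] [LinearOrder R] [IsStrictOrderedRing R]

section VFreeInduction

variable (ends : E → Sym2 V) (a₁ a₂ b v : V)

/-- An unresolved `v`-ROOT EDGE INTO A FREE VERTEX: `e = {x, z}` with `x` in the weight-`1` root
of `v`, `z` outside the roots of `v`, `a₁`, `a₂` and different from the marks `b` and `y`, and
`p e ∉ {0, 1}`. -/
def IsUnresolvedVRootEdgeFree (y : V) (p : E → R) (e : E) : Prop :=
  ∃ x z, ends e = s(x, z) ∧ x ∈ root p ends v ∧ z ∉ root p ends v ∧ z ∉ root p ends a₁ ∧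
    z ∉ root p ends a₂ ∧ z ≠ b ∧ z ≠ y ∧ p e ≠ 0 ∧ p e ≠ 1

/-- **(STEP-v-free)** — the one-edge statement of the `v`-exploration at the FREE edges, for
every mark `y`: `(K′)` for the two resolutions implies `(K′)` for the instance.  NOT proved here
(`MINE-C.md` §43.11–43.13). -/
def StepVFree : Prop :=
  ∀ (y : V) (p : E → R), IsProbVec p → ∀ e, IsUnresolvedVRootEdgeFree ends a₁ a₂ b v y p e →
    KPrimeHolds ends a₁ a₂ b v y (Function.update p e 0) →
      KPrimeHolds ends a₁ a₂ b v y (Function.update p e 1) →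
        KPrimeHolds ends a₁ a₂ b v y p

/-- **THE `v`-EXPLORATION, FREE EDGES ONLY**: `(STEP-v-free)` implies `(K′)` for every instance
and every mark `y`.  Strong induction on the number of unresolved edges, for all marks `y` at once:
an unresolved `v`-root edge into `y` is resolved by `kprimeHolds_of_update_zero_vy`, into `b` by
`kprimeHolds_of_update_zero_vb` (with the induction hypothesis at the mark `b`), into the root of
`a₁` / `a₂` by `kprimeHolds_of_update_zero_va₁` / `_va₂`, into a free vertex by `(STEP-v-free)`;
when none is left the root of `v` is exhausted and `kprime_of_exhausted_v` applies. -/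
theorem kprime_of_vstep_free (hstep : StepVFree (R := R) ends a₁ a₂ b v) :
    ∀ (y : V) (p : E → R), IsProbVec p → KPrimeHolds ends a₁ a₂ b v y p := by
  intro y p
  induction' hn : unres p using Nat.strong_induction_on with n ih generalizing y p
  intro hp
  by_cases h1r : a₁ ∈ root p ends v
  · exact kprimeHolds_of_a₁_mem_root_v h1r
  by_cases h2r : a₂ ∈ root p ends v
  · exact kprimeHolds_of_a₂_mem_root_v h2r
  by_cases hre : ∃ e, IsUnresolvedVRootEdge ends a₁ a₂ v p e
  · obtain ⟨e, x, z, hends, hx, hz, hz1, hz2, h0, h1⟩ := hre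
    have ih0 : ∀ y', KPrimeHolds ends a₁ a₂ b v y' (Function.update p e 0) := fun y' =>
      ih _ (hn ▸ unres_update_lt h0 h1 (Or.inl rfl)) y' (Function.update p e 0) rfl
        (hp.update e le_rfl zero_le_one)
    by_cases hzy : z = y
    · subst hzy
      exact kprimeHolds_of_update_zero_vy hp hends hx h1 (ih0 z)
    by_cases hzb : z = b
    · subst hzb
      exact kprimeHolds_of_update_zero_vb hp hends hx h1 (ih0 y) (ih0 z)
    have ih1 := ih _ (hn ▸ unres_update_lt h0 h1 (Or.inr rfl)) y (Function.update p e 1) rfl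
      (hp.update e zero_le_one le_rfl)
    exact hstep y p hp e ⟨x, z, hends, hx, hz, hz1, hz2, hzb, hzy, h0, h1⟩ (ih0 y) ih1
  simp only [not_exists] at hre
  by_cases hea : ∃ e x z, ends e = s(x, z) ∧ x ∈ root p ends v ∧ z ∈ root p ends a₁ ∧
      p e ≠ 0 ∧ p e ≠ 1
  · obtain ⟨e, x, z, hends, hx, hz, h0, h1⟩ := hea
    have ih0 := ih _ (hn ▸ unres_update_lt h0 h1 (Or.inl rfl)) y (Function.update p e 0) rfl
      (hp.update e le_rfl zero_le_one)
    exact kprimeHolds_of_update_zero_va₁ hp hends hx hz h1 ih0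
  by_cases heb : ∃ e x z, ends e = s(x, z) ∧ x ∈ root p ends v ∧ z ∈ root p ends a₂ ∧
      p e ≠ 0 ∧ p e ≠ 1
  · obtain ⟨e, x, z, hends, hx, hz, h0, h1⟩ := heb
    have ih0 := ih _ (hn ▸ unres_update_lt h0 h1 (Or.inl rfl)) y (Function.update p e 0) rfl
      (hp.update e le_rfl zero_le_one)
    exact kprimeHolds_of_update_zero_va₂ hp hends hx hz h1 ih0
  have hex : Exhausted p ends v := by
    intro e x z hends hx hz
    by_contra h0
    have h1 : p e ≠ 1 := fun h1 => hz (mem_root_of_one p hends hx h1)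
    by_cases hz1 : z ∈ root p ends a₁
    · exact hea ⟨e, x, z, hends, hx, hz1, h0, h1⟩
    by_cases hz2 : z ∈ root p ends a₂
    · exact heb ⟨e, x, z, hends, hx, hz2, h0, h1⟩
    exact hre e ⟨x, z, hends, hx, hz, hz1, hz2, h0, h1⟩
  exact kprime_of_exhausted_v hp hex h1r h2r

/-! ### The weakest damped one-edge statement: `(STEP-v)₁ : Φ_K(p) ≥ (1 − π)·Φ_K(p[e ↦ 0])` -/

/-- **(STEP-v)₁**, cleared: at every free `v`-root edge, for every mark `y`,
`(1 − p e)·P(N)·P(S)·form(p[e ↦ 0]) ≤ P⁰(N)·P⁰(S)·form(p)` — i.e. `Φ_K(p) ≥ (1 − π)·Φ_K(p[e ↦ 0])`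
with `π = P(e open | S)`: opening the edge loses at most the world-`1` share.  The weakest member
of the damped family `(STEP-v)_δ` of `MINE-C.md` §43.9 (`δ = 1`); NOT proved here. -/
def StepOne : Prop :=
  ∀ (y : V) (p : E → R), IsProbVec p → ∀ e, IsUnresolvedVRootEdgeFree ends a₁ a₂ b v y p e →
    (1 - p e) * prob p (N ends a₁ a₂ v) * prob p (S ends a₁ a₂ v) *
        kprimeForm ends a₁ a₂ b v y (Function.update p e 0)
          (prob (Function.update p e 0) (connEvent ends a₁ b ∩ N ends a₁ a₂ v))
          (prob (Function.update p e 0) (N ends a₁ a₂ v)) ≤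
      prob (Function.update p e 0) (N ends a₁ a₂ v) * prob (Function.update p e 0) (S ends a₁ a₂ v) *
        kprimeForm ends a₁ a₂ b v y p (prob p (connEvent ends a₁ b ∩ N ends a₁ a₂ v))
          (prob p (N ends a₁ a₂ v))

variable {ends a₁ a₂ b v}

omit [Fintype V] in
/-- `(STEP-v)₁` at an edge `e = {x, z}` from the root of `v` turns `(K′)(p[e ↦ 0])` into `(K′)(p)`:
the right-hand side `P⁰(N)·P⁰(S)·form(p)` is `≥ 0`, and when `P⁰(N) = 0` or `P⁰(S) = 0` the
parent's masses `P(N)`, resp. `P(S)`, vanish too (`N¹ ⊆ N`, `S¹ ⊆ S` through the dictionary) and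
`form(p) = 0`. -/
theorem kprimeHolds_of_stepOne {y : V} {p : E → R} {e : E} (hp : IsProbVec p) {x z : V}
    (hends : ends e = s(x, z)) (hx : x ∈ root p ends v) (he : p e ≠ 1)
    (h0 : KPrimeHolds ends a₁ a₂ b v y (Function.update p e 0))
    (hstep : (1 - p e) * prob p (N ends a₁ a₂ v) * prob p (S ends a₁ a₂ v) *
        kprimeForm ends a₁ a₂ b v y (Function.update p e 0)
          (prob (Function.update p e 0) (connEvent ends a₁ b ∩ N ends a₁ a₂ v))
          (prob (Function.update p e 0) (N ends a₁ a₂ v)) ≤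
      prob (Function.update p e 0) (N ends a₁ a₂ v) * prob (Function.update p e 0) (S ends a₁ a₂ v) *
        kprimeForm ends a₁ a₂ b v y p (prob p (connEvent ends a₁ b ∩ N ends a₁ a₂ v))
          (prob p (N ends a₁ a₂ v))) :
    KPrimeHolds ends a₁ a₂ b v y p := by
  have hp0 : IsProbVec (Function.update p e 0) := hp.update e le_rfl zero_le_one
  have h1t : 0 ≤ 1 - p e := sub_nonneg.2 (hp.le_one e)
  have hL : 0 ≤ prob (Function.update p e 0) (N ends a₁ a₂ v) *
      prob (Function.update p e 0) (S ends a₁ a₂ v) *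
      kprimeForm ends a₁ a₂ b v y p (prob p (connEvent ends a₁ b ∩ N ends a₁ a₂ v))
        (prob p (N ends a₁ a₂ v)) :=
    le_trans (mul_nonneg (mul_nonneg (mul_nonneg h1t (prob_nonneg hp _)) (prob_nonneg hp _)) h0)
      hstep
  -- `P¹(N) ≤ P⁰(N)` and `P¹(S) ≤ P⁰(S)`
  have hN1 : prob (Function.update p e 1) (N ends a₁ a₂ v) ≤
      prob (Function.update p e 0) (N ends a₁ a₂ v) := by
    rw [prob_N_vy (a₁ := a₁) (a₂ := a₂) (y := z) hends hx he]
    exact prob_mono hp0 Set.inter_subset_left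
  have hS1 : prob (Function.update p e 1) (S ends a₁ a₂ v) ≤
      prob (Function.update p e 0) (S ends a₁ a₂ v) := by
    rw [prob_S_vy (a₁ := a₁) (a₂ := a₂) (y := z) hends hx he]
    exact prob_mono hp0 Set.inter_subset_left
  have hNp := prob_eq_pin p (N ends a₁ a₂ v) e
  have hSp := prob_eq_pin p (S ends a₁ a₂ v) e
  have hXN_le : prob p (connEvent ends a₁ b ∩ N ends a₁ a₂ v) ≤ prob p (N ends a₁ a₂ v) :=
    prob_mono hp Set.inter_subset_right
  have hYS_le : prob p (connEvent ends a₂ y ∩ S ends a₁ a₂ v) ≤ prob p (S ends a₁ a₂ v) :=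
    prob_mono hp Set.inter_subset_right
  have hN1n := prob_nonneg (hp.update e zero_le_one le_rfl) (N ends a₁ a₂ v)
  have hS1n := prob_nonneg (hp.update e zero_le_one le_rfl) (S ends a₁ a₂ v)
  have hXNn := prob_nonneg hp (connEvent ends a₁ b ∩ N ends a₁ a₂ v)
  have hYSn := prob_nonneg hp (connEvent ends a₂ y ∩ S ends a₁ a₂ v)
  have ht0 := hp.nonneg e
  unfold KPrimeHolds
  rcases (prob_nonneg hp0 (N ends a₁ a₂ v)).eq_or_lt with hN0 | hN0
  · -- `P⁰(N) = 0`: `P(N) = 0`, `P(X ∩ N) = 0`, the form is `0`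
    have e1 : prob p (N ends a₁ a₂ v) = 0 := by
      have : prob (Function.update p e 1) (N ends a₁ a₂ v) = 0 := le_antisymm (hN0 ▸ hN1) hN1n
      rw [hNp, this, ← hN0]; ring
    have e2 : prob p (connEvent ends a₁ b ∩ N ends a₁ a₂ v) = 0 :=
      le_antisymm (e1 ▸ hXN_le) hXNn
    unfold kprimeForm
    rw [e1, e2]; ring_nf; exact le_rfl
  rcases (prob_nonneg hp0 (S ends a₁ a₂ v)).eq_or_lt with hS0 | hS0
  · -- `P⁰(S) = 0`: `P(S) = 0`, `P(Y ∩ S) = 0`, the form is `0`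
    have e1 : prob p (S ends a₁ a₂ v) = 0 := by
      have : prob (Function.update p e 1) (S ends a₁ a₂ v) = 0 := le_antisymm (hS0 ▸ hS1) hS1n
      rw [hSp, this, ← hS0]; ring
    have e2 : prob p (connEvent ends a₂ y ∩ S ends a₁ a₂ v) = 0 :=
      le_antisymm (e1 ▸ hYS_le) hYSn
    unfold kprimeForm
    rw [e1, e2]; ring_nf; exact le_rfl
  · rw [mul_assoc] at hL
    exact (mul_nonneg_iff_of_pos_left hS0).1 ((mul_nonneg_iff_of_pos_left hN0).1 hL)

variable (ends a₁ a₂ b v)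

/-- **`(STEP-v)₁` ⟹ `(K′)`**: the weakest damped one-edge statement at the free edges implies
`(K′)` for every instance and every mark `y` (through `kprime_of_vstep_free`). -/
theorem kprime_of_stepOne (hstep : StepOne (R := R) ends a₁ a₂ b v) :
    ∀ (y : V) (p : E → R), IsProbVec p → KPrimeHolds ends a₁ a₂ b v y p :=
  kprime_of_vstep_free ends a₁ a₂ b v fun y p hp e he h0 _ => by
    obtain ⟨x, z, hends, hx, _, _, _, _, _, _, h1⟩ := he
    exact kprimeHolds_of_stepOne hp hends hx h1 h0 (hstep y p hp e ⟨x, z, hends, hx, by assumption,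
      by assumption, by assumption, by assumption, by assumption, by assumption, h1⟩)


end VFreeInduction

end KPrime

end Summit.Ventures.PercRepro2
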